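import Literature.NumberTheory.Automorphic.ResGLnKugaAdInvariance
import Literature.NumberTheory.Automorphic.ResGLnKugaHarmonicRel
import HarnessLib

/-!
# Wigner's lemma for `C^•(𝔤, K_∞; W ⊗ E_λ)` and the coclosedness of basic non-trivial cocycles

Topic `NumberTheory/Automorphic`; namespace `Literature.NumberTheory.Automorphic.ConeDictionary`
(vocabulary of `ResGLnConeDictionary`, `ResGLnKugaHarmonic`).  Theorems only; no definition, no
named fact, no `sorry`.

* `casimir_scalar_eq_of_not_mem_coboundaries` — WIGNER: if the trace-form Casimir operators act on
  `W` (through `π`) and on `E_λ` by scalars `c`, `c'` and the complex `gkComplexLS π S λ` has a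
  cocycle which is not a coboundary, then `c = c'`
  (`GKTensor.casimir_scalar_eq_of_cohomology_ne_zero` with `hT`, `hTK`, `hTs` of
  `ResGLnKugaAdInvariance` / `ResGLnKugaHarmonic`);
* **`d_eq_zero_and_coclosed_of_not_mem_coboundaries`** — STEPS 0 + 2 of Borel's injectivity proof
  (`ResGLnCuspidalCohomologyApex`) COMBINED: given a positive Hermitian form on `W` skew along the
  `x i` and the two Casimir scalars, every BASIC cocycle `η` of positive degree of
  `gkComplexLS π S λ` which is NOT a coboundary is coclosed, `h η = 0`
  (`mem_rel_kPrimeD_of_basic_cocycle`, Wigner, `d_eq_zero_and_coclosed_of_casimir_scalar`).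

[cite: BorelWallach2000, I §4.1, §5.3; II §2.5, Prop. 3.1]

## References

* A. Borel, N. Wallach, *Continuous cohomology, discrete subgroups, and representations of reductive
  groups*, 2nd ed. (2000), I §4.1, §5.3, II §2.5, 3.1 (held). [BorelWallach2000]
-/

noncomputable section

namespace Literature.NumberTheory.Automorphic

-- Mathlib idiom (as in `GKModules`): commutator bracket on matrix algebras and `Module.End`
attribute [local instance 100] LieRing.ofAssociativeRing

-- `Classical`: the place subtypes indexing `mixedSpace K` are `Fintype` classically (as in `AdelicGLnGlue`).
open scoped TensorProduct Classical _root_.Matrix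
open _root_.NumberField _root_.NumberField.mixedEmbedding Literature.Algebra.Lie.ChevalleyEilenberg

namespace ConeDictionary

variable {n : ℕ} {K : Type} [Field K] [NumberField K] {hcpt : isCompact_glFiniteIntegralLevel n K}
  (π : AutomorphicRepData (AutomorphyDatum.gl n K hcpt))
  (S : Finset {w : InfinitePlace K // w.IsReal}) (lam : (K →+* ℂ) → Fin n → ℤ)

set_option maxHeartbeats 800000 in
-- the cohomology of `gkComplexLS` is `GKTensor.cohomology` of the two factors (definitional)
/-- **Wigner's lemma**: if the trace-form Casimir operators act on `W` and on `E_λ` by the scalars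
`c` and `c'`, and `C^•(𝔤, K_∞; W ⊗ E_λ)` has a cocycle which is not a coboundary, then `c = c'`.
[cite: BorelWallach2000, I §4.1, §5.3] -/
theorem casimir_scalar_eq_of_not_mem_coboundaries {c c' : ℂ}
    (hc : ∀ v : π.W, GKCasimir.op (AutomorphyDatum.gl n K hcpt).arch π.lieRepW (bD n K hcpt) (dD n K hcpt) v = c • v)
    (hc' : ∀ e : ResGLnCohomology.CoeffModule ℂ n K lam,
      GKCasimir.op (AutomorphyDatum.gl n K hcpt).arch (σ𝔤S hcpt lam) (bD n K hcpt) (dD n K hcpt) e = c' • e)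
    (q : ℕ) {η : Cochain π lam q} (hZ : η ∈ (gkComplexLS π S lam).cocycles q)
    (hB : η ∉ (gkComplexLS π S lam).coboundaries q) : c = c' :=
  GKTensor.casimir_scalar_eq_of_cohomology_ne_zero (AutomorphyDatum.gl n K hcpt).arch π.kRepW π.lieRepW
    π.kRepW_lieRepW_ad_compat (bD n K hcpt) (dD n K hcpt) (σSK hcpt S lam) (σ𝔤S hcpt lam) (σS_ad_compat S lam)
    (kugaD_hT_bD n K hcpt) (kugaD_hTK n K hcpt) (sum_dD_tmul_bD n K hcpt) hc hc' q
    ⟨(gkComplexLS π S lam).toCohomology q ⟨η, hZ⟩, fun h0 =>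
      hB (((gkComplexLS π S lam).toCohomology_eq_zero_iff q ⟨η, hZ⟩).1 h0)⟩

set_option maxHeartbeats 800000 in
-- as above
/-- **Steps 0 + 2 of Borel's injectivity proof, combined**: let `⟨ , ⟩_W` be a positive definite
Hermitian form on `W` along which the trace-zero Hermitian `x i` act skew-adjointly, and let the
trace-form Casimir operators act on `W` and on `E_λ` by scalars.  Then every BASIC cocycle
`η ∈ Z^{q+1}` of `C^•(𝔤, K_∞; W ⊗ E_λ)` (`i_Z η = 0`) which is NOT a coboundary is coclosed:
`h η = 0` for the homotopy `h` of `s = π ⊗ 1 - 1 ⊗ dE_λ` along `x` (and, trivially, closed).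
[cite: BorelWallach2000, II §2.5, Prop. 3.1; I §5.3] -/
theorem d_eq_zero_and_coclosed_of_not_mem_coboundaries {ip : π.W → π.W → ℂ} (hip : Kuga.IsPosForm ip)
    (hskew : ∀ (i : Fin (ResGLnCartan.pZeroDim n K)) (v v' : π.W),
      ip (π.lieDerivW (xD n K hcpt i) v) v' = -ip v (π.lieDerivW (xD n K hcpt i) v'))
    {c c' : ℂ}
    (hc : ∀ v : π.W, GKCasimir.op (AutomorphyDatum.gl n K hcpt).arch π.lieRepW (bD n K hcpt) (dD n K hcpt) v = c • v)
    (hc' : ∀ e : ResGLnCohomology.CoeffModule ℂ n K lam,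
      GKCasimir.op (AutomorphyDatum.gl n K hcpt).arch (σ𝔤S hcpt lam) (bD n K hcpt) (dD n K hcpt) e = c' • e)
    (q : ℕ) {η : Cochain π lam (q + 1)} (hZ : η ∈ (gkComplexLS π S lam).cocycles (q + 1))
    (hB : η ∉ (gkComplexLS π S lam).coboundaries (q + 1))
    (hins : ins q (⟨1, trivial⟩ : (AutomorphyDatum.gl n K hcpt).arch.lie) η = 0) :
    d ℝ (𝔤D n K hcpt) (Carrier π lam) (q + 1) η = 0 ∧
      casimirHomotopy (kugaS π lam) (xD n K hcpt) (xD n K hcpt) q η = 0 :=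
  have hZ' := ((gkComplexLS π S lam).mem_cocycles_iff (q + 1) η).1 hZ
  d_eq_zero_and_coclosed_of_casimir_scalar π lam hip hskew hc hc'
    (casimir_scalar_eq_of_not_mem_coboundaries π S lam hc hc' (q + 1) hZ hB) q
    (mem_rel_kPrimeD_of_basic_cocycle π S lam q hZ'.1 hins hZ'.2)

end ConeDictionary

end Literature.NumberTheory.Automorphic

end
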